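/-
Copyright (c) 2026 the pub-hodgecm-mathlib formalisation cell (harness21).  Prover seat hodgecm-mathlib-K2E1-p10 (g2), Track B ∕ K2-LIT (build stream 29),
h413 = `stmt-HodgeConjecture-24833`, route of record `HCCMUnconditional`, campaign «EIS-R7-BL-SPH-3»; dealer K2E1-plan (g6) ruling (62) 2026-09-04T10:20:27Z
(«the measure ∕ `hconj₃` ∕ `hdis′₃` inhabitation lemmas as a side file» for CLOSER₃ (c) `K2E1SphericalEisensteinMeromorphicU3`, assembly K2E1-p09 (g6)).
-/
import Summits.HodgeConjecture.HodgeConjecture.Theorems.K2E1BLFibreAverageInvarianceU       -- ★ p858957 (K2E1-p08): every-rank `integral_zFun_borelConstantTerm_eq_of_unfolding` (`hdis'` under `hconj`); brings ★ `K2E1BLQuotientMeasureU`, ★ `K2E1BLIotaUnfoldingU`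
import Summits.HodgeConjecture.HodgeConjecture.Theorems.K2E1IntertwinedSectionInvariance    -- ★ p857500: `map_conj_toAdelic_eq_self_three` (`hconj₃`, the product formula)
import Summits.HodgeConjecture.HodgeConjecture.Theorems.K2E1HeisenbergHaarU3                -- ★ (ν-2): `isInvInvariant_of_isHaarMeasure_adelicUnipotent_three`, `locallyCompactSpace_and_secondCountableTopology_adelicUnipotent`
import Literature.NumberTheory.Automorphic.UnitaryGroupUnipotentUnimodularThree             -- ★ `isMulRightInvariant_of_isHaarMeasure_adelicUnipotent_three`, `measure_ne_zero_of_isFundamentalDomain_rationalUnipotent`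
import Literature.NumberTheory.Automorphic.UnitaryGroupHeisenbergFundamentalDomain          -- ★ `heisFundamentalDomain`, `isFundamentalDomain_heisFundamentalDomain`, `exists_isCompact_heisFundamentalDomain_subset`
import Literature.NumberTheory.Automorphic.AdelicUnitaryGroupUnimodularQuasiSplit           -- ★ `forall_isHaarMeasure_isMulRightInvariant_quasiSplit_cm` (`U(J_N)(𝔸)` unimodular at the CM pair)
import Literature.NumberTheory.Automorphic.GLnIwasawaIntegration                            -- ★ `isInvInvariant_of_isMulRightInvariant` (unimodular ⇒ inversion-invariant)
import Literature.MeasureTheory.Group.CoveringWeights                                       -- ★ `exists_isCoveringWeight`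
import HarnessLib

/-!
# h413 ∕ Track B «K2-LIT», campaign «EIS-R7-BL-SPH-3» — helper `K2E1SphericalEisensteinStructuralDataCMThree`: THE STRUCTURAL LETTERS OF THE `U(2,1)` CLOSER ARE INHABITED
# (Haar measure and Tate–Rogawski fundamental domain of the Heisenberg radical `N(𝔸)`, covering weight `β` and unfolded measure `μZ` on `Z = B(F)∖G(𝔸)`, unimodularity of
# `U(J₃)(𝔸)`), AND THE DISINTEGRATION LETTER `hdis'` OF (S)₃ IS A THEOREM AT `N = 3`

Cell `pub/hodgecm-mathlib`, crux h413 = `stmt-HodgeConjecture-24833`, route of record `HCCMUnconditional`; chair K2-lead (g1), dealer K2E1-plan (g6) ruling (62) 2026-09-04T10:20:27Z: the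
CLOSER₃ assembly `sphericalEisenstein_meromorphic_cm_three_of_hK1` (K2E1-p09 (g6), N = 3 twin of ★ p859271 `K2E1SphericalEisensteinMeromorphicU2`) keeps the binders that its letter
`hK1₃` mentions (`μ`, `νG`, `hβ`, `hμZ`) and obtains everything else from THIS file: the Heisenberg-radical package `(ν, 𝓕)` (§2), the `N = 3` discharge of the (S)₃ letter `hdis'`
(§4, ★ every-rank `integral_zFun_borelConstantTerm_eq_of_unfolding` ∘ ★ `map_conj_toAdelic_eq_self_three`), the right-invariance `hright` of `μZ` (§5); and, for the letter-free
corollary once `hK1_cm_three` lands, a Haar measure `νG` with a covering weight `β` and an unfolded s-finite measure `μZ` (§1 every rank, §3 at the CM pair).  THEOREMS ONLY (no `def`,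
no `instance`, no notation, no `sorry`); lane `--supports stmt-HodgeConjecture-24833 --as helper` (count-neutral).  Closes no socket.

* §1 (every rank `(F, E, c, N)`): `sFinite_of_unfolding` (`μZ = π_*(β ν_G)` is s-finite), **`exists_coveringWeight_unfoldedMeasure`** (`∃ β μZ, IsCoveringWeight B(F)♯ β ∧ SFinite μZ ∧ hμZ`).
* §2 (`U(2,1)_{L∕L⁺}`): **`exists_unipotent_haar_fundamentalDomain_cm_three`** — `∃ ν 𝓕`, `ν` a Haar measure of `N(𝔸)` right- and inversion-invariant (★ Rogawski §1.10: `N(F)∖N(𝔸)`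
  compact ⇒ unimodular), `𝓕 = heisFundamentalDomain` a fundamental domain of `N(F)` with compact closure and `0 < ν 𝓕 < ∞`.
* §3 (`U(2,1)_{L∕L⁺}`, `G`-side): `isMulRightInvariant_of_isHaarMeasure_cm_three`, `isInvInvariant_of_isHaarMeasure_cm_three`, **`exists_haar_coveringWeight_unfoldedMeasure_cm_three`**.
* §4 (`U(2,1)_{L∕L⁺}`): **`integral_zFun_borelConstantTerm_eq_cm_three`** = the `hdis'` binder of ★ (S)₃ `sphericalEisenstein_solves_xSystem_cm_three` VERBATIM (every `k`, `a`), and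
  `integral_zFun_borelConstantTerm_eq_of_isCompact_closure_cm_three` (`h𝓕₀`, `h𝓕top` derived from `IsCompact (closure 𝓕)`).
* §5 (`U(2,1)_{L∕L⁺}`): **`measurePreserving_rightShift_cm_three`** (★ `hright`, unimodularity discharged).

HONEST LABEL: HC_CM is proved only modulo the 7 printed citations (2 remaining named inputs: hLiu418 = `stmt-HodgeConjecture-24832`, h413 = `stmt-HodgeConjecture-24833`) until rung 0
closes; this file asserts no named fact and closes no socket.
References: [BernsteinLapid2019] J. Bernstein, E. Lapid, *On the meromorphic continuation of Eisenstein series*, arXiv:1911.02342 (JAMS 37 (2024)), §4 Claim 4 (p. 10);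
[Rogawski1990] J. D. Rogawski, *Automorphic Representations of Unitary Groups in Three Variables*, §1.10, §2.1; [MoeglinWaldspurger1995] C. Mœglin, J.-L. Waldspurger, *Spectral
Decomposition and Eisenstein Series*, I.2.1, I.2.6, II.1.7; [WeilIntegration1965] A. Weil, *L'intégration dans les groupes topologiques*, §9; [DeitmarEchterhoff2014] A. Deitmar,
S. Echterhoff, *Principles of Harmonic Analysis*, Thm. 9.1.6.
-/

set_option autoImplicit false
-- the mandated namespace repeats `HodgeConjecture.HodgeConjecture`, as in every `Theorems/*.lean` of this sub-problem
set_option linter.dupNamespace false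

noncomputable section

open MeasureTheory MeasureTheory.Measure Set NumberField Filter Topology
open scoped NNReal ENNReal
open Literature.MeasureTheory.Group Literature.NumberTheory.Automorphic Literature.NumberTheory.Automorphic.UnitaryGroup AdelicGroupData
open Summit.HodgeConjecture.HodgeConjecture.Cruxes.H413.K2E1BLBorelSpacesU2Defs
open Summit.HodgeConjecture.HodgeConjecture.Cruxes.H413.K2E1BLIotaUnfoldingU (exists_measure_forall_lintegral_eq discreteTopology_map_arithmeticBorel)
open Summit.HodgeConjecture.HodgeConjecture.Cruxes.H413.K2E1BLQuotientMeasureU (measurePreserving_rightShift_of_unfolding map_toBorelQuotient_withDensity_eq_of_unfolding)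
open Summit.HodgeConjecture.HodgeConjecture.Cruxes.H413.K2E1BLFibreAverageInvarianceU (integral_zFun_borelConstantTerm_eq_of_unfolding)
open Summit.HodgeConjecture.HodgeConjecture.Cruxes.H413.K2E1IntertwinedSectionInvariance (map_conj_toAdelic_eq_self_three)
open Summit.HodgeConjecture.HodgeConjecture.Cruxes.H413.K2E1HeisenbergHaarU3 (isInvInvariant_of_isHaarMeasure_adelicUnipotent_three
  locallyCompactSpace_and_secondCountableTopology_adelicUnipotent)

namespace Summit.HodgeConjecture.HodgeConjecture.Cruxes.H413.K2E1SphericalEisensteinStructuralDataCMThree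

/-! ## §1 Every rank: the covering weight `β` of `B(F)♯` and the unfolded measure `μZ = π_*(β ν_G)` exist, `μZ` is s-finite -/

section Generic

variable {F E : Type} [Field F] [NumberField F] [Field E] [NumberField E] [Algebra F E] {c : E ≃ₐ[F] E} {N : ℕ}
  [MeasurableSpace (quasiSplit F E c N).Adelic] [BorelSpace (quasiSplit F E c N).Adelic]

/-- **`μZ` IS S-FINITE** under the measure letter `hμZ` with `ν_G` s-finite: `μZ = π_*(β · ν_G)` (★ `map_toBorelQuotient_withDensity_eq_of_unfolding`) and push-forwards of
densities of s-finite measures are s-finite (Mathlib). [cite: WeilIntegration1965, §9] -/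
theorem sFinite_of_unfolding (νG : Measure (quasiSplit F E c N).Adelic) [SFinite νG]
    {β : (quasiSplit F E c N).Adelic → ℝ≥0∞} (hβ : IsCoveringWeight ↥((arithmeticBorel F E c N).map (quasiSplit F E c N).arithmeticSubgroup.subtype) β)
    {μZ : Measure (borelQuotient F E c N)}
    (hμZ : ∀ f : borelQuotient F E c N → ℝ≥0∞, Measurable f → ∫⁻ z, f z ∂μZ = ∫⁻ g, β g * f (toBorelQuotient F E c N g) ∂νG) :
    SFinite μZ := by
  rw [← map_toBorelQuotient_withDensity_eq_of_unfolding νG hβ hμZ]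
  infer_instance

/-- **THE MEASURE LETTERS `hβ`, `hμZ` ARE JOINTLY INHABITED, WITH `μZ` S-FINITE** (every rank): for every left-invariant s-finite `ν_G` on `G(𝔸)` there are a covering weight `β`
of the discrete subgroup `B(F)♯ ≤ G(𝔸)` (★ `exists_isCoveringWeight` over ★ `discreteTopology_map_arithmeticBorel`) and an s-finite measure `μZ` on `Z = B(F)∖G(𝔸)` with
`∫⁻_Z f dμZ = ∫⁻_𝔾 β·(f∘π) dν_G` for all Borel `f ≥ 0` (★ `exists_measure_forall_lintegral_eq`). [cite: WeilIntegration1965, §9] [cite: MoeglinWaldspurger1995, I.2.1] -/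
theorem exists_coveringWeight_unfoldedMeasure (νG : Measure (quasiSplit F E c N).Adelic) [νG.IsMulLeftInvariant] [SFinite νG] :
    ∃ (β : (quasiSplit F E c N).Adelic → ℝ≥0∞) (μZ : Measure (borelQuotient F E c N)),
      IsCoveringWeight ↥((arithmeticBorel F E c N).map (quasiSplit F E c N).arithmeticSubgroup.subtype) β ∧ SFinite μZ ∧
      ∀ f : borelQuotient F E c N → ℝ≥0∞, Measurable f → ∫⁻ z, f z ∂μZ = ∫⁻ g, β g * f (toBorelQuotient F E c N g) ∂νG := by
  haveI := t2Space_adeleRing_of_numberField E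
  haveI := locallyCompactSpace_adeleRing' E
  haveI := secondCountableTopology_adeleRing E
  haveI : SecondCountableTopology (quasiSplit F E c N).Adelic := inferInstanceAs (SecondCountableTopology (adelic F E c N ((StdForm.antidiagonal N).over E)))
  haveI := discreteTopology_map_arithmeticBorel (F := F) (E := E) (c := c) (N := N)
  obtain ⟨β, hβ⟩ := exists_isCoveringWeight ((arithmeticBorel F E c N).map (quasiSplit F E c N).arithmeticSubgroup.subtype)
  obtain ⟨μZ, hμZ⟩ := exists_measure_forall_lintegral_eq νG hβ
  exact ⟨β, μZ, hβ, sFinite_of_unfolding νG hβ hμZ, hμZ⟩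

end Generic

/-! ## §2–§5 The CM pair `(L⁺, L)`, `N = 3` -/

section CMThree

variable (L : Type) [Field L] [NumberField L] [IsCMField L]
  [MeasurableSpace (quasiSplit (↥(maximalRealSubfield L)) L (IsCMField.complexConj L) 3).Adelic] [BorelSpace (quasiSplit (↥(maximalRealSubfield L)) L (IsCMField.complexConj L) 3).Adelic]

/-- **THE HEISENBERG-RADICAL PACKAGE OF `U(2,1)_{L∕L⁺}` IS INHABITED**: there are a Haar measure `ν` on `N(𝔸)` which is right-invariant (`N(F)∖N(𝔸)` is compact, hence `N(𝔸)`
unimodular — ★ `isMulRightInvariant_of_isHaarMeasure_adelicUnipotent_three`) and inversion-invariant (★ `isInvInvariant_of_isHaarMeasure_adelicUnipotent_three`), and a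
fundamental domain `𝓕` of `N(F)` in `N(𝔸)` (★ Tate–Rogawski `heisFundamentalDomain`) with compact closure (★ `exists_isCompact_heisFundamentalDomain_subset`) and
`0 < ν 𝓕 < ∞` — the binders `(ν) [IsHaarMeasure] [IsMulRightInvariant] [IsInvInvariant] (h𝓕N) (h𝓕c) (h𝓕₀)` of ★ (S)₃, ★ (b1)₃ and the closer. [cite: Rogawski1990, §1.10 and §2.1]
[cite: MoeglinWaldspurger1995, I.2.1] -/
theorem exists_unipotent_haar_fundamentalDomain_cm_three :
    ∃ (ν : Measure ↥(adelicUnipotent (↥(maximalRealSubfield L)) L (IsCMField.complexConj L) 3))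
      (𝓕 : Set ↥(adelicUnipotent (↥(maximalRealSubfield L)) L (IsCMField.complexConj L) 3)),
      ν.IsHaarMeasure ∧ ν.IsMulRightInvariant ∧ ν.IsInvInvariant ∧
      IsFundamentalDomain ↥(rationalUnipotent (↥(maximalRealSubfield L)) L (IsCMField.complexConj L) 3) 𝓕 ν ∧
      IsCompact (closure 𝓕) ∧ ν 𝓕 ≠ 0 ∧ ν 𝓕 ≠ ∞ := by
  have hc : IsCMField.complexConj L * IsCMField.complexConj L = 1 := AlgEquiv.ext fun x => IsCMField.complexConj_apply_apply L x
  haveI := t2Space_adeleRing_of_numberField L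
  haveI : T2Space (quasiSplit (↥(maximalRealSubfield L)) L (IsCMField.complexConj L) 3).Adelic :=
    inferInstanceAs (T2Space (adelic (↥(maximalRealSubfield L)) L (IsCMField.complexConj L) 3 ((StdForm.antidiagonal 3).over L)))
  obtain ⟨h₁, h₂⟩ := locallyCompactSpace_and_secondCountableTopology_adelicUnipotent (F := ↥(maximalRealSubfield L)) (E := L) (c := IsCMField.complexConj L) (N := 3)
  haveI := h₁
  haveI := h₂
  letI : MeasurableSpace (AdeleRing (𝓞 L) L) := borel _
  haveI : BorelSpace (AdeleRing (𝓞 L) L) := ⟨rfl⟩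
  have h𝓕N := isFundamentalDomain_heisFundamentalDomain (F := ↥(maximalRealSubfield L)) (E := L) (c := IsCMField.complexConj L) hc
    (haar : Measure ↥(adelicUnipotent (↥(maximalRealSubfield L)) L (IsCMField.complexConj L) 3))
  obtain ⟨C, hC, hsub⟩ := exists_isCompact_heisFundamentalDomain_subset (F := ↥(maximalRealSubfield L)) (E := L) (c := IsCMField.complexConj L) hc
  exact ⟨haar, heisFundamentalDomain (↥(maximalRealSubfield L)) L (IsCMField.complexConj L) hc, inferInstance,
    isMulRightInvariant_of_isHaarMeasure_adelicUnipotent_three hc _, isInvInvariant_of_isHaarMeasure_adelicUnipotent_three hc _, h𝓕N,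
    hC.closure_of_subset hsub, measure_ne_zero_of_isFundamentalDomain_rationalUnipotent _ h𝓕N, ((measure_mono hsub).trans_lt hC.measure_lt_top).ne⟩

/-- **EVERY HAAR MEASURE OF `U(J₃)(𝔸_{L⁺})` IS RIGHT-INVARIANT** (unimodularity at the CM pair, ★ `forall_isHaarMeasure_isMulRightInvariant_quasiSplit_cm`).
[cite: MoeglinWaldspurger1995, I.2.1] [cite: DeitmarEchterhoff2014, Thm. 9.1.6] -/
theorem isMulRightInvariant_of_isHaarMeasure_cm_three (νG : Measure (quasiSplit (↥(maximalRealSubfield L)) L (IsCMField.complexConj L) 3).Adelic) [νG.IsHaarMeasure] :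
    νG.IsMulRightInvariant :=
  forall_isHaarMeasure_isMulRightInvariant_quasiSplit_cm L (by norm_num) νG inferInstance

/-- **EVERY HAAR MEASURE OF `U(J₃)(𝔸_{L⁺})` IS INVERSION-INVARIANT** (unimodular ⇒ `ν_G(A⁻¹) = ν_G(A)`, ★ `isInvInvariant_of_isMulRightInvariant`).
[cite: DeitmarEchterhoff2014, Thm. 9.1.6] [cite: MoeglinWaldspurger1995, I.2.1] -/
theorem isInvInvariant_of_isHaarMeasure_cm_three (νG : Measure (quasiSplit (↥(maximalRealSubfield L)) L (IsCMField.complexConj L) 3).Adelic) [νG.IsHaarMeasure] :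
    νG.IsInvInvariant := by
  haveI := t2Space_adeleRing_of_numberField L
  haveI := locallyCompactSpace_adeleRing' L
  haveI := secondCountableTopology_adeleRing L
  haveI : LocallyCompactSpace (quasiSplit (↥(maximalRealSubfield L)) L (IsCMField.complexConj L) 3).Adelic :=
    inferInstanceAs (LocallyCompactSpace (adelic (↥(maximalRealSubfield L)) L (IsCMField.complexConj L) 3 ((StdForm.antidiagonal 3).over L)))
  haveI : SecondCountableTopology (quasiSplit (↥(maximalRealSubfield L)) L (IsCMField.complexConj L) 3).Adelic :=
    inferInstanceAs (SecondCountableTopology (adelic (↥(maximalRealSubfield L)) L (IsCMField.complexConj L) 3 ((StdForm.antidiagonal 3).over L)))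
  haveI := isMulRightInvariant_of_isHaarMeasure_cm_three L νG
  exact isInvInvariant_of_isMulRightInvariant νG

/-- **THE `G`-SIDE STRUCTURAL LETTERS ARE JOINTLY INHABITED AT `U(2,1)_{L∕L⁺}`**: a Haar measure `νG` of `G(𝔸)` (right- and inversion-invariant, s-finite), a covering weight `β`
of `B(F)♯` and an s-finite `μZ` on `Z = B(F)∖G(𝔸)` with the unfolding identity `hμZ` — the binders `(νG) [IsHaarMeasure] [IsInvInvariant] [SFinite] (hβ) [SFinite μZ] (hμZ)` of the
closer and of the `hK1₃` discharge. [cite: WeilIntegration1965, §9] [cite: MoeglinWaldspurger1995, I.2.1] -/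
theorem exists_haar_coveringWeight_unfoldedMeasure_cm_three :
    ∃ (νG : Measure (quasiSplit (↥(maximalRealSubfield L)) L (IsCMField.complexConj L) 3).Adelic)
      (β : (quasiSplit (↥(maximalRealSubfield L)) L (IsCMField.complexConj L) 3).Adelic → ℝ≥0∞)
      (μZ : Measure (borelQuotient (↥(maximalRealSubfield L)) L (IsCMField.complexConj L) 3)),
      νG.IsHaarMeasure ∧ νG.IsMulRightInvariant ∧ νG.IsInvInvariant ∧ SFinite νG ∧
      IsCoveringWeight ↥((arithmeticBorel (↥(maximalRealSubfield L)) L (IsCMField.complexConj L) 3).map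
        (quasiSplit (↥(maximalRealSubfield L)) L (IsCMField.complexConj L) 3).arithmeticSubgroup.subtype) β ∧ SFinite μZ ∧
      ∀ f : borelQuotient (↥(maximalRealSubfield L)) L (IsCMField.complexConj L) 3 → ℝ≥0∞, Measurable f →
        ∫⁻ z, f z ∂μZ = ∫⁻ g, β g * f (toBorelQuotient (↥(maximalRealSubfield L)) L (IsCMField.complexConj L) 3 g) ∂νG := by
  haveI := t2Space_adeleRing_of_numberField L
  haveI := locallyCompactSpace_adeleRing' L
  haveI := secondCountableTopology_adeleRing L
  haveI : LocallyCompactSpace (quasiSplit (↥(maximalRealSubfield L)) L (IsCMField.complexConj L) 3).Adelic :=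
    inferInstanceAs (LocallyCompactSpace (adelic (↥(maximalRealSubfield L)) L (IsCMField.complexConj L) 3 ((StdForm.antidiagonal 3).over L)))
  haveI : SecondCountableTopology (quasiSplit (↥(maximalRealSubfield L)) L (IsCMField.complexConj L) 3).Adelic :=
    inferInstanceAs (SecondCountableTopology (adelic (↥(maximalRealSubfield L)) L (IsCMField.complexConj L) 3 ((StdForm.antidiagonal 3).over L)))
  haveI : (haar : Measure (quasiSplit (↥(maximalRealSubfield L)) L (IsCMField.complexConj L) 3).Adelic).IsMulRightInvariant :=
    isMulRightInvariant_of_isHaarMeasure_cm_three L haar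
  haveI : (haar : Measure (quasiSplit (↥(maximalRealSubfield L)) L (IsCMField.complexConj L) 3).Adelic).IsInvInvariant :=
    isInvInvariant_of_isHaarMeasure_cm_three L haar
  obtain ⟨β, μZ, hβ, hsf, hμZ⟩ := exists_coveringWeight_unfoldedMeasure (haar : Measure (quasiSplit (↥(maximalRealSubfield L)) L (IsCMField.complexConj L) 3).Adelic)
  exact ⟨haar, β, μZ, inferInstance, inferInstance, inferInstance, inferInstance, hβ, hsf, hμZ⟩

/-- **THE DISINTEGRATION LETTER `hdis'` OF ★ (S)₃ `sphericalEisenstein_solves_xSystem_cm_three` IS A THEOREM AT `U(2,1)_{L∕L⁺}`** (every weight `k` and level `a`): for Borel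
left-`B(F)`-invariant `Φ` with `zFun Φ`, `zFun Φ_B` integrable w.r.t. `wtm_{k,a} μZ`, `∫_Z zFun Φ_B d(wtm) = ∫_Z zFun Φ d(wtm)` — ★ every-rank `integral_zFun_borelConstantTerm_eq_of_unfolding`
with its conjugation letter `hconj` discharged by the product formula ★ `map_conj_toAdelic_eq_self_three`. [cite: BernsteinLapid2019, §4 Claim 4 (p. 10)] [cite: MoeglinWaldspurger1995, II.1.7 and I.2.6] -/
theorem integral_zFun_borelConstantTerm_eq_cm_three
    (νG : Measure (quasiSplit (↥(maximalRealSubfield L)) L (IsCMField.complexConj L) 3).Adelic) [νG.IsHaarMeasure]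
    (ν : Measure ↥(adelicUnipotent (↥(maximalRealSubfield L)) L (IsCMField.complexConj L) 3)) [ν.IsHaarMeasure] [ν.IsInvInvariant]
    {𝓕 : Set ↥(adelicUnipotent (↥(maximalRealSubfield L)) L (IsCMField.complexConj L) 3)}
    (h𝓕N : IsFundamentalDomain ↥(rationalUnipotent (↥(maximalRealSubfield L)) L (IsCMField.complexConj L) 3) 𝓕 ν) (h𝓕₀ : ν 𝓕 ≠ 0) (h𝓕top : ν 𝓕 ≠ ∞)
    {β : (quasiSplit (↥(maximalRealSubfield L)) L (IsCMField.complexConj L) 3).Adelic → ℝ≥0∞}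
    (hβ : IsCoveringWeight ↥((arithmeticBorel (↥(maximalRealSubfield L)) L (IsCMField.complexConj L) 3).map
      (quasiSplit (↥(maximalRealSubfield L)) L (IsCMField.complexConj L) 3).arithmeticSubgroup.subtype) β)
    {μZ : Measure (borelQuotient (↥(maximalRealSubfield L)) L (IsCMField.complexConj L) 3)}
    (hμZ : ∀ f : borelQuotient (↥(maximalRealSubfield L)) L (IsCMField.complexConj L) 3 → ℝ≥0∞, Measurable f →
      ∫⁻ z, f z ∂μZ = ∫⁻ g, β g * f (toBorelQuotient (↥(maximalRealSubfield L)) L (IsCMField.complexConj L) 3 g) ∂νG)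
    (k : ℕ) (a : ℝ≥0) :
    ∀ Φ : (quasiSplit (↥(maximalRealSubfield L)) L (IsCMField.complexConj L) 3).Adelic → ℂ, Measurable Φ →
      (∀ b ∈ ratBorelSubgroup (↥(maximalRealSubfield L)) L (IsCMField.complexConj L) 3, ∀ g, Φ (b * g) = Φ g) →
      Integrable (zFun (↥(maximalRealSubfield L)) L (IsCMField.complexConj L) 3 Φ) (weightedTruncMeasure (↥(maximalRealSubfield L)) L (IsCMField.complexConj L) 3 k a μZ) →
      Integrable (zFun (↥(maximalRealSubfield L)) L (IsCMField.complexConj L) 3 (borelConstantTerm ν 𝓕 Φ)) (weightedTruncMeasure (↥(maximalRealSubfield L)) L (IsCMField.complexConj L) 3 k a μZ) →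
        ∫ x, zFun (↥(maximalRealSubfield L)) L (IsCMField.complexConj L) 3 (borelConstantTerm ν 𝓕 Φ) x ∂(weightedTruncMeasure (↥(maximalRealSubfield L)) L (IsCMField.complexConj L) 3 k a μZ) =
          ∫ x, zFun (↥(maximalRealSubfield L)) L (IsCMField.complexConj L) 3 Φ x ∂(weightedTruncMeasure (↥(maximalRealSubfield L)) L (IsCMField.complexConj L) 3 k a μZ) := by
  have hc : IsCMField.complexConj L * IsCMField.complexConj L = 1 := AlgEquiv.ext fun x => IsCMField.complexConj_apply_apply L x
  have hc1 : IsCMField.complexConj L ≠ 1 := IsCMField.complexConj_ne_one L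
  intro Φ hΦm hΦB hint hint'
  exact integral_zFun_borelConstantTerm_eq_of_unfolding νG ν (fun _ hb₀ => map_conj_toAdelic_eq_self_three hc hc1 ν hb₀) h𝓕N h𝓕₀ h𝓕top hβ hμZ k a hΦm hΦB hint hint'

/-- **`hdis'` AT `U(2,1)_{L∕L⁺}` FROM THE CLOSER'S BINDERS `(h𝓕N) (h𝓕c : IsCompact (closure 𝓕))`**: `0 < ν 𝓕` for every fundamental domain of `N(F)` (★
`measure_ne_zero_of_isFundamentalDomain_rationalUnipotent`) and `ν 𝓕 ≤ ν (closure 𝓕) < ∞`; then §4. [cite: BernsteinLapid2019, §4 Claim 4 (p. 10)] [cite: Rogawski1990, §2.1] -/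
theorem integral_zFun_borelConstantTerm_eq_of_isCompact_closure_cm_three
    (νG : Measure (quasiSplit (↥(maximalRealSubfield L)) L (IsCMField.complexConj L) 3).Adelic) [νG.IsHaarMeasure]
    (ν : Measure ↥(adelicUnipotent (↥(maximalRealSubfield L)) L (IsCMField.complexConj L) 3)) [ν.IsHaarMeasure] [ν.IsInvInvariant]
    {𝓕 : Set ↥(adelicUnipotent (↥(maximalRealSubfield L)) L (IsCMField.complexConj L) 3)}
    (h𝓕N : IsFundamentalDomain ↥(rationalUnipotent (↥(maximalRealSubfield L)) L (IsCMField.complexConj L) 3) 𝓕 ν) (h𝓕c : IsCompact (closure 𝓕))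
    {β : (quasiSplit (↥(maximalRealSubfield L)) L (IsCMField.complexConj L) 3).Adelic → ℝ≥0∞}
    (hβ : IsCoveringWeight ↥((arithmeticBorel (↥(maximalRealSubfield L)) L (IsCMField.complexConj L) 3).map
      (quasiSplit (↥(maximalRealSubfield L)) L (IsCMField.complexConj L) 3).arithmeticSubgroup.subtype) β)
    {μZ : Measure (borelQuotient (↥(maximalRealSubfield L)) L (IsCMField.complexConj L) 3)}
    (hμZ : ∀ f : borelQuotient (↥(maximalRealSubfield L)) L (IsCMField.complexConj L) 3 → ℝ≥0∞, Measurable f →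
      ∫⁻ z, f z ∂μZ = ∫⁻ g, β g * f (toBorelQuotient (↥(maximalRealSubfield L)) L (IsCMField.complexConj L) 3 g) ∂νG)
    (k : ℕ) (a : ℝ≥0) :
    ∀ Φ : (quasiSplit (↥(maximalRealSubfield L)) L (IsCMField.complexConj L) 3).Adelic → ℂ, Measurable Φ →
      (∀ b ∈ ratBorelSubgroup (↥(maximalRealSubfield L)) L (IsCMField.complexConj L) 3, ∀ g, Φ (b * g) = Φ g) →
      Integrable (zFun (↥(maximalRealSubfield L)) L (IsCMField.complexConj L) 3 Φ) (weightedTruncMeasure (↥(maximalRealSubfield L)) L (IsCMField.complexConj L) 3 k a μZ) →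
      Integrable (zFun (↥(maximalRealSubfield L)) L (IsCMField.complexConj L) 3 (borelConstantTerm ν 𝓕 Φ)) (weightedTruncMeasure (↥(maximalRealSubfield L)) L (IsCMField.complexConj L) 3 k a μZ) →
        ∫ x, zFun (↥(maximalRealSubfield L)) L (IsCMField.complexConj L) 3 (borelConstantTerm ν 𝓕 Φ) x ∂(weightedTruncMeasure (↥(maximalRealSubfield L)) L (IsCMField.complexConj L) 3 k a μZ) =
          ∫ x, zFun (↥(maximalRealSubfield L)) L (IsCMField.complexConj L) 3 Φ x ∂(weightedTruncMeasure (↥(maximalRealSubfield L)) L (IsCMField.complexConj L) 3 k a μZ) :=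
  integral_zFun_borelConstantTerm_eq_cm_three L νG ν h𝓕N (measure_ne_zero_of_isFundamentalDomain_rationalUnipotent _ h𝓕N)
    ((measure_mono subset_closure).trans_lt h𝓕c.measure_lt_top).ne hβ hμZ k a

/-- **`μZ` IS RIGHT-INVARIANT AT `U(2,1)_{L∕L⁺}`** (the closer's `hright`): ★ every-rank `measurePreserving_rightShift_of_unfolding` with the right-invariance of the Haar measure
`ν_G` discharged by unimodularity (§3). [cite: BernsteinLapid2019, §4 (p. 10)] [cite: WeilIntegration1965, §9] -/
theorem measurePreserving_rightShift_cm_three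
    (νG : Measure (quasiSplit (↥(maximalRealSubfield L)) L (IsCMField.complexConj L) 3).Adelic) [νG.IsHaarMeasure]
    {β : (quasiSplit (↥(maximalRealSubfield L)) L (IsCMField.complexConj L) 3).Adelic → ℝ≥0∞}
    (hβ : IsCoveringWeight ↥((arithmeticBorel (↥(maximalRealSubfield L)) L (IsCMField.complexConj L) 3).map
      (quasiSplit (↥(maximalRealSubfield L)) L (IsCMField.complexConj L) 3).arithmeticSubgroup.subtype) β)
    {μZ : Measure (borelQuotient (↥(maximalRealSubfield L)) L (IsCMField.complexConj L) 3)}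
    (hμZ : ∀ f : borelQuotient (↥(maximalRealSubfield L)) L (IsCMField.complexConj L) 3 → ℝ≥0∞, Measurable f →
      ∫⁻ z, f z ∂μZ = ∫⁻ g, β g * f (toBorelQuotient (↥(maximalRealSubfield L)) L (IsCMField.complexConj L) 3 g) ∂νG)
    (y : (quasiSplit (↥(maximalRealSubfield L)) L (IsCMField.complexConj L) 3).Adelic) :
    MeasurePreserving (rightShift (↥(maximalRealSubfield L)) L (IsCMField.complexConj L) 3 y) μZ μZ := by
  haveI := isMulRightInvariant_of_isHaarMeasure_cm_three L νG
  exact measurePreserving_rightShift_of_unfolding νG hβ hμZ y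

end CMThree

end Summit.HodgeConjecture.HodgeConjecture.Cruxes.H413.K2E1SphericalEisensteinStructuralDataCMThree

end
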